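/-
Copyright (c) 2026 the pub-hodgecm-mathlib formalisation cell (harness21).  Prover seat hodgecm-mathlib-F0P2-p02 (g26), lineage successor of F0P2-p02 (g25);
E1 keeper ∕ dealer F0P3a-p03 (g29), E1 BRICK LEDGER row 40 «K2′-π² SELF-EXTENSION ASSEMBLY modulo (ND) @ DATUM», generic spine G2 = (G1d) + (g1) + (G1e) + (G1f)
of the census `F0/P2/p02/g25/k2pi2/CENSUS-K2PI2-SELFEXT.v1` eb22afb6.
-/
import Literature.RepresentationTheory.JetEmbeddingExclusion        -- ★ G1 p853217: `forall_fst_eq_zero_of_not_deforms` (brings ★ row 32 `JetWindowTransfer`)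
import Literature.RepresentationTheory.IntertwiningMapTwoStepTarget  -- ★ row 24 p853111: `finrank_intertwiningMap_eq_of_forall_apply_mem`
import Literature.Algebra.Module.ExtensionSplitting                -- ★ HOM-COUNT-SPLIT p852801: `exists_section_of_finrank_hom_le`
import HarnessLib

/-!
# Self-extensions of an irreducible constituent `A ≤ π₀` with `Hom_G(A, π₀ ∕ A) = 0`: every `G`-map from a sub-source lands in `A`,
# and the extension SPLITS as soon as `dim Hom_G(X, π₀) ≥ 2` or it maps into the jet module with a non-zero first projection (the latter is excluded by (ND))

Generic representation theory, THEOREMS ONLY (no `def`, no instance, no notation, no named fact, no `sorry`), Mathlib + the tree's ★ `JetEmbeddingExclusion` (G1, row 40),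
★ `IntertwiningMapTwoStepTarget` (row 24) and ★ `Algebra/Module/ExtensionSplitting` (HOM-COUNT-SPLIT).  Letters of G1 ∕ row 32 VERBATIM: `π₀ : Representation k G V`,
`A : Submodule k V` with `hAinv : ∀ g, A ≤ A.comap (π₀ g)` (so `π₀|_A = π₀.subrepresentation A hAinv`, `π₀ ∕ A = π₀.quotient A hAinv`), irreducibility
`hAirr : ∀ B ≤ A, (∀ g, B ≤ B.comap (π₀ g)) → B = ⊥ ∨ B = A`, the jet data `(π₁, h1, hL, ρ, hρ)` and (ND) `hnd` of ★ row 32.  NEW letters (hypothesis-style, Mathlib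
`Representation.IntertwiningMap`): **`hHom0 : ∀ ψ : IntertwiningMap (π₀.subrepresentation A hAinv) (π₀.quotient A hAinv), ψ = 0`** («`Hom_G(A, V ∕ A) = 0`»), a representation
`τ` on `X` which is an EXTENSION OF `A` BY `A`: `ι : IntertwiningMap (π₀|_A) τ`, `p : IntertwiningMap τ (π₀|_A)` with `hexact : ker p = range ι` (and `hp : Surjective p` where a
section is produced), and Schur `hSchur : finrank_k End_G(π₀|_A) = 1`.

* §1 TWO VANISHING DEVICES from `hHom0` (any commutative ring `k`, any monoid `G`): an equivariant `f : A → V` takes values in `A` (`forall_apply_mem_of_equivariant`: `[f] : A → V ∕ A`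
  is a `G`-map); more generally an equivariant `f : Y → V` that sends `ker q` into `A`, for an equivariant SURJECTION `q : Y ↠ A`, takes values in `A`
  (`forall_apply_mem_of_factor_surjective`: `[f]` descends along `q` to a `G`-map `A → V ∕ A`).
* §2 **LENGTH-TWO BOOKKEEPING** (`forall_apply_mem_of_selfExtension`, census (G1d)): if `τ` is an extension of `A` by `A` (`hexact` only), `A` irreducible and `Hom_G(A, V ∕ A) = 0`,
  then EVERY equivariant `k`-linear map from ANY `τ`-invariant submodule `X′ ≤ X` to `V` takes values in `A` — exactly G1's hypothesis `hrange`, in G1's plain letters.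
  Proof: `ι⁻¹(X′)` and `p(X′)` are invariant submodules of `A`, hence `⊥` or `A`; the four cases reduce to §1 (`X′ ∩ ι(A) ∈ {0, ι(A)}`, then descend along `p|_{X′}`).
  Corollary `forall_intertwiningMap_apply_mem_of_selfExtension` (`X′ = ⊤`: every `G`-map `X → V` lands in `A`) and, over a field, the dimension transfer
  `finrank_intertwiningMap_selfExtension_eq` (`dim Hom_G(X, A) = dim Hom_G(X, V)`, ★ row 24).
* §3 **HOM-COUNT-SPLIT IN `IntertwiningMap` LETTERS** (`exists_section_intertwiningMap_of_finrank_le`, census (g1); `k` a field): ★ `ExtensionSplitting.exists_section_of_finrank_hom_le`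
  transported along Mathlib `IntertwiningMap.equivLinearMapAsModule : Hom_G(ρ, σ) ≃ₗ[k] Hom_{k[G]}(ρ.asModule, σ.asModule)`; then **`exists_section_of_two_le_finrank`** (census (G1e)):
  a self-extension of `A` with `A` irreducible, `Hom_G(A, V ∕ A) = 0`, Schur, and `2 ≤ dim_k Hom_G(X, V)` SPLITS (`∃ s, p ∘ s = 1`).
* §4 **THE ASSEMBLY** (`exists_section_of_two_le_finrank_or_exists_jet`, census (G1f)): under (ND) in row 32's letters, the ALTERNATIVE «`2 ≤ dim Hom_G(X, V)` OR there is an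
  equivariant `φ : X → V × V` into the jet module of `(π₀, π₁)` with some `(φ x).1 ≠ 0`» implies that the self-extension splits — the second disjunct being IMPOSSIBLE by ★ G1
  `forall_fst_eq_zero_of_not_deforms` fed with §2.  USE (row 40 datum file, census §0 D): at `G = U(Φ₃)(L⁺_v)`, `π₀ = I₀ = i_B(χ)`, `A = π²`, the exact Jacquet functor makes
  `r_B E` an extension of `χ` by `χ`, which is `χ ⊕ χ` (Frobenius: `dim Hom_G(E, I₀) = 2`) or the unipotent model `N_λ` (Frobenius + ★ J1∕J2: an equivariant map into the jet with
  non-zero first projection) — so `E` splits GIVEN (ND), i.e. «K2′-π²-alg ⟸ (ND)».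

SOURCES (what is formalised, read at our letters).  [BernsteinZelevinsky1976, §2.1–§2.4, 2.8–2.9 p. 16]: `Hom` bookkeeping between subquotients of finite-length
representations and the dimension count that splits an extension («`dim End = 2 ⇒` decomposable»); [Casselman1995, §6.3–§6.4]: Jordan–Hölder bookkeeping of `Hom` spaces for
admissible representations; [HuybrechtsLehn1997, App. 2.A.7]: first-order deformations of a sub-object and the obstruction read on maps into the thickening (the (ND) branch, via
★ G1 ∕ row 32); [Keys1984, §3]: the application — reducible unitary principal series of rank-one unitary groups have no self-extensions between their constituents beyond the
ones forced by the Jacquet module.  Deliberately NOT here: Jacquet modules, induction, the unitary group, or (ND) itself (a hypothesis; [Keys1984] proves it where the cell needs it).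
HONEST LABEL: count-neutral generic layer; (ND), `hHom0`, Schur and the alternative are hypotheses; HC_CM is proved only modulo the printed citations until rung 0 closes.
-/

set_option autoImplicit false

namespace Literature.RepresentationTheory

open Representation

/-! ## §1 Two vanishing devices from `Hom_G(A, V ∕ A) = 0` -/

section Devices

variable {k : Type*} [CommRing k] {G : Type*} [Monoid G] {V : Type*} [AddCommGroup V] [Module k V]
variable {Y : Type*} [AddCommGroup Y] [Module k Y]

/-- **AN EQUIVARIANT `f : A → V` TAKES VALUES IN `A`** when `Hom_G(A, V ∕ A) = 0`: the composite `A → V → V ∕ A` is a `G`-map, hence zero.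
[cite: BernsteinZelevinsky1976, §2.1–§2.4] [cite: Casselman1995, §6.3] -/
theorem forall_apply_mem_of_equivariant (π₀ : Representation k G V) (A : Submodule k V) (hAinv : ∀ g, A ≤ A.comap (π₀ g))
    (hHom0 : ∀ ψ : IntertwiningMap (π₀.subrepresentation A hAinv) (π₀.quotient A hAinv), ψ = 0)
    (f : A →ₗ[k] V) (hf : ∀ (g : G) (a : A), f (π₀.subrepresentation A hAinv g a) = π₀ g (f a)) (a : A) : f a ∈ A := by
  have hψ : ∀ (g : G) (b : A), (A.mkQ ∘ₗ f) (π₀.subrepresentation A hAinv g b) = π₀.quotient A hAinv g ((A.mkQ ∘ₗ f) b) :=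
    fun g b => by
      rw [LinearMap.comp_apply, LinearMap.comp_apply, hf, Submodule.mkQ_apply, Submodule.mkQ_apply, Representation.quotient_apply,
        Submodule.mapQ_apply]
  have h0 := hHom0 ((A.mkQ ∘ₗ f).intertwiningMap_of_isIntertwiningMap _ _ hψ)
  have ha : (A.mkQ ∘ₗ f) a = 0 := by
    have := congrArg (fun ψ : IntertwiningMap (π₀.subrepresentation A hAinv) (π₀.quotient A hAinv) => ψ a) h0
    simpa using this
  rw [LinearMap.comp_apply, Submodule.mkQ_apply, Submodule.Quotient.mk_eq_zero] at ha
  exact ha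

/-- **DESCENT ALONG AN EQUIVARIANT SURJECTION ONTO `A`.**  Let `σ` be a representation on `Y`, `q : Y ↠ A` a `k`-linear equivariant surjection onto `π₀|_A`, and
`f : Y → V` equivariant with `f (ker q) ⊆ A`.  If `Hom_G(A, V ∕ A) = 0` then `f` takes values in `A`: `[f] : Y → V ∕ A` kills `ker q`, so it descends to a `G`-map
`A ≅ Y ∕ ker q → V ∕ A`, which vanishes. [cite: BernsteinZelevinsky1976, §2.1–§2.4] [cite: Casselman1995, §6.3] -/
theorem forall_apply_mem_of_factor_surjective (π₀ : Representation k G V) (A : Submodule k V) (hAinv : ∀ g, A ≤ A.comap (π₀ g))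
    (hHom0 : ∀ ψ : IntertwiningMap (π₀.subrepresentation A hAinv) (π₀.quotient A hAinv), ψ = 0)
    (σ : Representation k G Y) (q : Y →ₗ[k] A) (hq : ∀ (g : G) (y : Y), q (σ g y) = π₀.subrepresentation A hAinv g (q y))
    (hqs : Function.Surjective q) (f : Y →ₗ[k] V) (hf : ∀ (g : G) (y : Y), f (σ g y) = π₀ g (f y))
    (hker : ∀ y, q y = 0 → f y ∈ A) (y : Y) : f y ∈ A := by
  -- `[f] := mkQ ∘ f` kills `ker q`
  have hle : LinearMap.ker q ≤ LinearMap.ker (A.mkQ ∘ₗ f) := fun z hz => by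
    rw [LinearMap.mem_ker, LinearMap.comp_apply, Submodule.mkQ_apply, Submodule.Quotient.mk_eq_zero]
    exact hker z (LinearMap.mem_ker.1 hz)
  -- descend along `q`
  let ψ₀ : A →ₗ[k] V ⧸ A := ((LinearMap.ker q).liftQ (A.mkQ ∘ₗ f) hle) ∘ₗ (q.quotKerEquivOfSurjective hqs).symm.toLinearMap
  have hψ₀ : ∀ z : Y, ψ₀ (q z) = Submodule.Quotient.mk (f z) := fun z => by
    change ((LinearMap.ker q).liftQ (A.mkQ ∘ₗ f) hle) ((q.quotKerEquivOfSurjective hqs).symm (q z)) = _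
    rw [LinearMap.quotKerEquivOfSurjective_symm_apply, Submodule.liftQ_apply]
    rfl
  have hψeq : ∀ (g : G) (a : A), ψ₀ (π₀.subrepresentation A hAinv g a) = π₀.quotient A hAinv g (ψ₀ a) := fun g a => by
    obtain ⟨z, rfl⟩ := hqs a
    rw [← hq, hψ₀, hψ₀, hf, Representation.quotient_apply, Submodule.mapQ_apply]
  have h0 := hHom0 (ψ₀.intertwiningMap_of_isIntertwiningMap _ _ hψeq)
  have hy : ψ₀ (q y) = 0 := by
    have := congrArg (fun ψ : IntertwiningMap (π₀.subrepresentation A hAinv) (π₀.quotient A hAinv) => ψ (q y)) h0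
    simpa using this
  rw [hψ₀, Submodule.Quotient.mk_eq_zero] at hy
  exact hy

end Devices

/-! ## §2 Length-two bookkeeping: every `G`-map from a sub-source of a self-extension of `A` lands in `A` -/

section LengthTwo

variable {k : Type*} [CommRing k] {G : Type*} [Monoid G] {V : Type*} [AddCommGroup V] [Module k V]
variable {X : Type*} [AddCommGroup X] [Module k X]

/-- **LENGTH-TWO BOOKKEEPING** (census (G1d)).  Let `A ≤ V` be `π₀`-invariant and IRREDUCIBLE among invariant submodules, with `Hom_G(A, V ∕ A) = 0`, and let `τ` on `X` be an
extension of `A` by `A`: `ι : π₀|_A → τ`, `p : τ → π₀|_A` equivariant with `ker p = range ι`.  Then every equivariant `k`-linear map `f` from a `τ`-invariant submodule `X′ ≤ X`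
to `V` takes values in `A` — G1's hypothesis `hrange`, in G1's letters.  Proof: `ι⁻¹(X′)` and `p(X′)` are invariant submodules of `A`, so each is `⊥` or `A`
(irreducibility); `f` vanishes modulo `A` on `X′ ∩ ι(A)` (§1 applied to `f ∘ ι` when `ι(A) ≤ X′`, trivially when `X′ ∩ ι(A) = 0`), and then on `X′` (trivially when
`p(X′) = 0`, i.e. `X′ ≤ ι(A)`; by descent along the surjection `p|_{X′} : X′ ↠ A` otherwise). [cite: BernsteinZelevinsky1976, §2.1–§2.4] [cite: Casselman1995, §6.3–§6.4] -/
theorem forall_apply_mem_of_selfExtension (π₀ : Representation k G V) (A : Submodule k V) (hAinv : ∀ g, A ≤ A.comap (π₀ g))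
    (hAirr : ∀ B : Submodule k V, B ≤ A → (∀ g, B ≤ B.comap (π₀ g)) → B = ⊥ ∨ B = A)
    (hHom0 : ∀ ψ : IntertwiningMap (π₀.subrepresentation A hAinv) (π₀.quotient A hAinv), ψ = 0)
    (τ : Representation k G X) (ι : IntertwiningMap (π₀.subrepresentation A hAinv) τ) (p : IntertwiningMap τ (π₀.subrepresentation A hAinv))
    (hexact : LinearMap.ker p.toLinearMap = LinearMap.range ι.toLinearMap)
    (X' : Submodule k X) (hX' : ∀ g, X' ≤ X'.comap (τ g)) (f : X' →ₗ[k] V)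
    (hf : ∀ (g : G) (x : X'), f ⟨τ g x, hX' g x.2⟩ = π₀ g (f x)) (x : X') : f x ∈ A := by
  -- STEP 1: `f x ∈ A` whenever `x ∈ ι(A)`, via the invariant submodule `B := ι⁻¹(X′)` of `A`
  have hV1 : ∀ x : X', (x : X) ∈ LinearMap.range ι.toLinearMap → f x ∈ A := by
    have hBinv : ∀ g, (X'.comap ι.toLinearMap).map A.subtype ≤ ((X'.comap ι.toLinearMap).map A.subtype).comap (π₀ g) := by
      intro g v hv
      obtain ⟨a, ha, rfl⟩ := Submodule.mem_map.1 hv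
      rw [Submodule.mem_comap]
      refine Submodule.mem_map.2 ⟨π₀.subrepresentation A hAinv g a, ?_, rfl⟩
      rw [Submodule.mem_comap] at ha ⊢
      change ι (π₀.subrepresentation A hAinv g a) ∈ X'
      rw [IntertwiningMap.isIntertwining _ _ ι g a]
      exact hX' g ha
    rcases hAirr ((X'.comap ι.toLinearMap).map A.subtype) (Submodule.map_subtype_le _ _) hBinv with hB | hB
    · -- `X′ ∩ ι(A) = 0`
      rintro x ⟨a, ha⟩
      have haB : (a : V) ∈ (X'.comap ι.toLinearMap).map A.subtype := by
        refine Submodule.mem_map.2 ⟨a, ?_, rfl⟩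
        rw [Submodule.mem_comap, ha]
        exact x.2
      rw [hB, Submodule.mem_bot] at haB
      have ha0 : a = 0 := (Submodule.coe_eq_zero).1 haB
      have hx0 : x = 0 := (Submodule.coe_eq_zero).1 (by rw [← ha, ha0, map_zero])
      rw [hx0, map_zero]
      exact A.zero_mem
    · -- `ι(A) ≤ X′`: apply §1 to `f ∘ ι`
      have hιX : ∀ a : A, ι a ∈ X' := fun a => by
        have haB : (a : V) ∈ (X'.comap ι.toLinearMap).map A.subtype := by
          rw [hB]
          exact a.2
        obtain ⟨a', ha', haa'⟩ := Submodule.mem_map.1 haB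
        have haa : a' = a := Subtype.ext haa'
        rw [Submodule.mem_comap, haa] at ha'
        exact ha'
      rintro x ⟨a, ha⟩
      let ι' : A →ₗ[k] X' := ι.toLinearMap.codRestrict X' hιX
      have key := forall_apply_mem_of_equivariant π₀ A hAinv hHom0 (f ∘ₗ ι') (fun g b => by
        rw [LinearMap.comp_apply, LinearMap.comp_apply, ← hf g (ι' b)]
        congr 1
        apply Subtype.ext
        change ι (π₀.subrepresentation A hAinv g b) = τ g (ι b)
        exact IntertwiningMap.isIntertwining _ _ ι g b) a
      have hxa : x = ι' a := Subtype.ext (by change (x : X) = ι a; exact ha.symm)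
      rw [hxa]
      exact key
  -- STEP 2: the invariant submodule `B′ := p(X′)` of `A`
  have hB'inv : ∀ g, (X'.map p.toLinearMap).map A.subtype ≤ ((X'.map p.toLinearMap).map A.subtype).comap (π₀ g) := by
    intro g v hv
    obtain ⟨b, hb, rfl⟩ := Submodule.mem_map.1 hv
    obtain ⟨y, hy, rfl⟩ := Submodule.mem_map.1 hb
    rw [Submodule.mem_comap]
    refine Submodule.mem_map.2 ⟨π₀.subrepresentation A hAinv g (p.toLinearMap y), Submodule.mem_map.2 ⟨τ g y, hX' g hy, ?_⟩, rfl⟩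
    change p (τ g y) = π₀.subrepresentation A hAinv g (p y)
    exact IntertwiningMap.isIntertwining _ _ p g y
  rcases hAirr ((X'.map p.toLinearMap).map A.subtype) (Submodule.map_subtype_le _ _) hB'inv with hB' | hB'
  · -- `p(X′) = 0`: `X′ ≤ ker p = ι(A)`
    apply hV1
    rw [← hexact, LinearMap.mem_ker]
    have hpx : (p.toLinearMap (x : X) : V) ∈ (X'.map p.toLinearMap).map A.subtype :=
      Submodule.mem_map.2 ⟨p.toLinearMap (x : X), Submodule.mem_map.2 ⟨(x : X), x.2, rfl⟩, rfl⟩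
    rw [hB', Submodule.mem_bot] at hpx
    exact (Submodule.coe_eq_zero).1 hpx
  · -- `p(X′) = A`: descend along `p|_{X′} : X′ ↠ A`
    have hsurj : Function.Surjective (p.toLinearMap ∘ₗ X'.subtype) := fun a => by
      have haB : (a : V) ∈ (X'.map p.toLinearMap).map A.subtype := by
        rw [hB']
        exact a.2
      obtain ⟨b, hb, hba⟩ := Submodule.mem_map.1 haB
      obtain ⟨y, hy, rfl⟩ := Submodule.mem_map.1 hb
      exact ⟨⟨y, hy⟩, Subtype.ext hba⟩
    refine forall_apply_mem_of_factor_surjective π₀ A hAinv hHom0 (τ.subrepresentation X' hX') (p.toLinearMap ∘ₗ X'.subtype)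
      (fun g y => IntertwiningMap.isIntertwining _ _ p g (y : X)) hsurj f (fun g y => hf g y) (fun y hy => hV1 y ?_) x
    rw [← hexact, LinearMap.mem_ker]
    exact hy

/-- **EVERY `G`-MAP `X → V` FROM A SELF-EXTENSION OF `A` LANDS IN `A`** (`X′ = ⊤` in `forall_apply_mem_of_selfExtension`). [cite: BernsteinZelevinsky1976, §2.1–§2.4]
[cite: Casselman1995, §6.3–§6.4] -/
theorem forall_intertwiningMap_apply_mem_of_selfExtension (π₀ : Representation k G V) (A : Submodule k V) (hAinv : ∀ g, A ≤ A.comap (π₀ g))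
    (hAirr : ∀ B : Submodule k V, B ≤ A → (∀ g, B ≤ B.comap (π₀ g)) → B = ⊥ ∨ B = A)
    (hHom0 : ∀ ψ : IntertwiningMap (π₀.subrepresentation A hAinv) (π₀.quotient A hAinv), ψ = 0)
    (τ : Representation k G X) (ι : IntertwiningMap (π₀.subrepresentation A hAinv) τ) (p : IntertwiningMap τ (π₀.subrepresentation A hAinv))
    (hexact : LinearMap.ker p.toLinearMap = LinearMap.range ι.toLinearMap) (f : IntertwiningMap τ π₀) (x : X) : f x ∈ A :=
  forall_apply_mem_of_selfExtension π₀ A hAinv hAirr hHom0 τ ι p hexact ⊤ (fun _ _ _ => Submodule.mem_top)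
    (f.toLinearMap ∘ₗ (⊤ : Submodule k X).subtype) (fun g y => IntertwiningMap.isIntertwining _ _ f g (y : X)) ⟨x, Submodule.mem_top⟩

end LengthTwo

/-! ## §3 Hom-count splitting in `IntertwiningMap` letters, and the split branch -/

section HomCount

universe u v w w' w''

variable {k : Type u} [Field k] {G : Type v} [Monoid G]
  {V : Type w} [AddCommGroup V] [Module k V] {X : Type w'} [AddCommGroup X] [Module k X] {X' : Type w''} [AddCommGroup X'] [Module k X']

/-- **`dim_k Hom_G(X, A) = dim_k Hom_G(X, V)`** for a self-extension `X` of the irreducible constituent `A ≤ V` with `Hom_G(A, V ∕ A) = 0` (§2 + ★ row 24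
`finrank_intertwiningMap_eq_of_forall_apply_mem`, read through `⟨A, hAinv⟩ : Subrepresentation π₀`). [cite: BernsteinZelevinsky1976, §2.1–§2.4; 2.8–2.9 p. 16] [cite: Casselman1995, §6.3–§6.4] -/
theorem finrank_intertwiningMap_selfExtension_eq (π₀ : Representation k G V) (A : Submodule k V) (hAinv : ∀ g, A ≤ A.comap (π₀ g))
    (hAirr : ∀ B : Submodule k V, B ≤ A → (∀ g, B ≤ B.comap (π₀ g)) → B = ⊥ ∨ B = A)
    (hHom0 : ∀ ψ : IntertwiningMap (π₀.subrepresentation A hAinv) (π₀.quotient A hAinv), ψ = 0)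
    (τ : Representation k G X) (ι : IntertwiningMap (π₀.subrepresentation A hAinv) τ) (p : IntertwiningMap τ (π₀.subrepresentation A hAinv))
    (hexact : LinearMap.ker p.toLinearMap = LinearMap.range ι.toLinearMap) :
    Module.finrank k (IntertwiningMap τ (π₀.subrepresentation A hAinv)) = Module.finrank k (IntertwiningMap τ π₀) :=
  finrank_intertwiningMap_eq_of_forall_apply_mem (⟨A, fun g _ hv => hAinv g hv⟩ : Subrepresentation π₀)
    (forall_intertwiningMap_apply_mem_of_selfExtension π₀ A hAinv hAirr hHom0 τ ι p hexact)

/-- **HOM-COUNT-SPLIT IN `IntertwiningMap` LETTERS** (census (g1)).  `L —ι→ E —p→ L′` equivariant with `p` surjective and `ker p = range ι`, `Hom_G(E, L)`, `Hom_G(L′, L)`,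
`End_G(L)` finite-dimensional over the field `k` with `dim Hom_G(L′, L) + dim End_G(L) ≤ dim Hom_G(E, L)`: then `p` has an EQUIVARIANT section.  This is ★
`ExtensionSplitting.exists_section_of_finrank_hom_le` over the group algebra `k[G]`, transported along Mathlib's `IntertwiningMap.equivLinearMapAsModule`.
[cite: BernsteinZelevinsky1976, §2.1–§2.4; 2.8–2.9 p. 16] [cite: Keys1984, §3] -/
theorem exists_section_intertwiningMap_of_finrank_le (σL : Representation k G V) (σE : Representation k G X) (σL' : Representation k G X')
    (ι : IntertwiningMap σL σE) (p : IntertwiningMap σE σL') (hp : Function.Surjective p)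
    (hexact : LinearMap.ker p.toLinearMap = LinearMap.range ι.toLinearMap)
    [FiniteDimensional k (IntertwiningMap σE σL)] [FiniteDimensional k (IntertwiningMap σL' σL)] [FiniteDimensional k (IntertwiningMap σL σL)]
    (hdim : Module.finrank k (IntertwiningMap σL' σL) + Module.finrank k (IntertwiningMap σL σL) ≤ Module.finrank k (IntertwiningMap σE σL)) :
    ∃ s : IntertwiningMap σL' σE, p.comp s = IntertwiningMap.id σL' := by
  -- the three transports `Hom_G(·, ·) ≃ₗ[k] Hom_{k[G]}(·.asModule, ·.asModule)`
  let eEL := IntertwiningMap.equivLinearMapAsModule σE σL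
  let eL'L := IntertwiningMap.equivLinearMapAsModule σL' σL
  let eLL := IntertwiningMap.equivLinearMapAsModule σL σL
  haveI : FiniteDimensional k (σE.asModule →ₗ[MonoidAlgebra k G] σL.asModule) := Module.Finite.equiv eEL
  haveI : FiniteDimensional k (σL'.asModule →ₗ[MonoidAlgebra k G] σL.asModule) := Module.Finite.equiv eL'L
  haveI : FiniteDimensional k (σL.asModule →ₗ[MonoidAlgebra k G] σL.asModule) := Module.Finite.equiv eLL
  have hdim' : Module.finrank k (σL'.asModule →ₗ[MonoidAlgebra k G] σL.asModule)
      + Module.finrank k (σL.asModule →ₗ[MonoidAlgebra k G] σL.asModule)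
      ≤ Module.finrank k (σE.asModule →ₗ[MonoidAlgebra k G] σL.asModule) := by
    rw [← eL'L.finrank_eq, ← eLL.finrank_eq, ← eEL.finrank_eq]
    exact hdim
  -- the sequence over `k[G]`
  have hp' : Function.Surjective (IntertwiningMap.equivLinearMapAsModule σE σL' p) := fun y => by
    obtain ⟨x, hx⟩ := hp y
    exact ⟨x, hx⟩
  have hexact' : LinearMap.ker (IntertwiningMap.equivLinearMapAsModule σE σL' p)
      = LinearMap.range (IntertwiningMap.equivLinearMapAsModule σL σE ι) := by
    ext x
    exact SetLike.ext_iff.1 hexact x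
  obtain ⟨s', hs'⟩ := Literature.Algebra.Module.ExtensionSplitting.exists_section_of_finrank_hom_le (k := k)
    (IntertwiningMap.equivLinearMapAsModule σL σE ι) (IntertwiningMap.equivLinearMapAsModule σE σL' p) hp' hexact' hdim'
  refine ⟨(IntertwiningMap.equivLinearMapAsModule σL' σE).symm s', IntertwiningMap.ext (LinearMap.ext fun l => ?_)⟩
  have h := congrArg (fun f => f l) hs'
  exact h

/-- **THE SPLIT BRANCH** (census (G1e)).  A self-extension `0 → A —ι→ X —p→ A → 0` (`p` surjective, `ker p = range ι`) of an irreducible invariant `A ≤ π₀` with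
`Hom_G(A, V ∕ A) = 0` and Schur `dim_k End_G(A) = 1` SPLITS as soon as `2 ≤ dim_k Hom_G(X, V)`: by §2 `dim Hom_G(X, A) = dim Hom_G(X, V) ≥ 2 = dim Hom_G(A, A) + dim End_G(A)`,
and HOM-COUNT-SPLIT gives the section. [cite: BernsteinZelevinsky1976, §2.1–§2.4; 2.8–2.9 p. 16] [cite: Keys1984, §3] -/
theorem exists_section_of_two_le_finrank (π₀ : Representation k G V) (A : Submodule k V) (hAinv : ∀ g, A ≤ A.comap (π₀ g))
    (hAirr : ∀ B : Submodule k V, B ≤ A → (∀ g, B ≤ B.comap (π₀ g)) → B = ⊥ ∨ B = A)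
    (hHom0 : ∀ ψ : IntertwiningMap (π₀.subrepresentation A hAinv) (π₀.quotient A hAinv), ψ = 0)
    (hSchur : Module.finrank k (IntertwiningMap (π₀.subrepresentation A hAinv) (π₀.subrepresentation A hAinv)) = 1)
    (τ : Representation k G X) (ι : IntertwiningMap (π₀.subrepresentation A hAinv) τ) (p : IntertwiningMap τ (π₀.subrepresentation A hAinv))
    (hp : Function.Surjective p) (hexact : LinearMap.ker p.toLinearMap = LinearMap.range ι.toLinearMap)
    (h2 : 2 ≤ Module.finrank k (IntertwiningMap τ π₀)) :
    ∃ s : IntertwiningMap (π₀.subrepresentation A hAinv) τ, p.comp s = IntertwiningMap.id (π₀.subrepresentation A hAinv) := by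
  have hfr := finrank_intertwiningMap_selfExtension_eq π₀ A hAinv hAirr hHom0 τ ι p hexact
  haveI : FiniteDimensional k (IntertwiningMap τ (π₀.subrepresentation A hAinv)) := Module.finite_of_finrank_pos (by omega)
  haveI : FiniteDimensional k (IntertwiningMap (π₀.subrepresentation A hAinv) (π₀.subrepresentation A hAinv)) :=
    Module.finite_of_finrank_eq_succ hSchur
  exact exists_section_intertwiningMap_of_finrank_le _ _ _ ι p hp hexact (by omega)

/-! ## §4 The assembly: split by Hom-count, or map into the jet — which (ND) forbids -/

/-- **SELF-EXTENSIONS SPLIT FROM THE ALTERNATIVE, GIVEN (ND)** (census (G1f)).  Let `A ≤ π₀` be invariant and irreducible with `Hom_G(A, V ∕ A) = 0` and Schur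
`dim End_G(A) = 1`, let `(π₁, h1, hL, ρ, hρ)` be a first-order deformation of `π₀` with its jet module, and assume (ND): `A` does NOT deform to first order along `(π₀, π₁)`
(★ row 32's `hnd` verbatim).  If a self-extension `0 → A → X → A → 0` satisfies the ALTERNATIVE — `2 ≤ dim_k Hom_G(X, V)`, OR some equivariant `φ : X → V × V` into the jet
module has a non-zero first component — then it SPLITS: the first branch is §3, the second is EMPTY by ★ G1 `forall_fst_eq_zero_of_not_deforms` (fed with §2's `hrange`).
[cite: HuybrechtsLehn1997, App. 2.A.7 (Flags of subsheaves)] [cite: BernsteinZelevinsky1976, §2.1–§2.4; 2.8–2.9 p. 16] [cite: Keys1984, §3] -/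
theorem exists_section_of_two_le_finrank_or_exists_jet (π₀ : Representation k G V) (π₁ : G → Module.End k V) (h1 : π₁ 1 = 0)
    (hL : ∀ g h, π₁ (g * h) = π₁ g * π₀ h + π₀ g * π₁ h) (ρ : Representation k G (V × V))
    (hρ : ∀ g v₀ v₁, ρ g (v₀, v₁) = (π₀ g v₀, π₁ g v₀ + π₀ g v₁)) (A : Submodule k V)
    (hAinv : ∀ g, A ≤ A.comap (π₀ g))
    (hAirr : ∀ B : Submodule k V, B ≤ A → (∀ g, B ≤ B.comap (π₀ g)) → B = ⊥ ∨ B = A)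
    (hnd : ¬ ∃ L : A →ₗ[k] V, ∀ g (a : A), π₁ g (a : V) + π₀ g (L a) - L (π₀.subrepresentation A hAinv g a) ∈ A)
    (hHom0 : ∀ ψ : IntertwiningMap (π₀.subrepresentation A hAinv) (π₀.quotient A hAinv), ψ = 0)
    (hSchur : Module.finrank k (IntertwiningMap (π₀.subrepresentation A hAinv) (π₀.subrepresentation A hAinv)) = 1)
    (τ : Representation k G X) (ι : IntertwiningMap (π₀.subrepresentation A hAinv) τ) (p : IntertwiningMap τ (π₀.subrepresentation A hAinv))
    (hp : Function.Surjective p) (hexact : LinearMap.ker p.toLinearMap = LinearMap.range ι.toLinearMap)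
    (halt : 2 ≤ Module.finrank k (IntertwiningMap τ π₀) ∨
      ∃ φ : X →ₗ[k] V × V, (∀ g x, φ (τ g x) = ρ g (φ x)) ∧ ∃ x, (φ x).1 ≠ 0) :
    ∃ s : IntertwiningMap (π₀.subrepresentation A hAinv) τ, p.comp s = IntertwiningMap.id (π₀.subrepresentation A hAinv) := by
  rcases halt with h2 | ⟨φ, hφ, x, hx⟩
  · exact exists_section_of_two_le_finrank π₀ A hAinv hAirr hHom0 hSchur τ ι p hp hexact h2
  · exact absurd (forall_fst_eq_zero_of_not_deforms π₀ π₁ h1 hL ρ hρ A hAinv hAirr hnd τ φ hφ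
      (forall_apply_mem_of_selfExtension π₀ A hAinv hAirr hHom0 τ ι p hexact) x) hx

/-- **NO EQUIVARIANT MAP INTO THE JET WITH NON-ZERO FIRST PROJECTION, from a self-extension, under (ND)** — the (ND) half of the assembly on its own (any such `φ` is
excluded; no Schur, no surjectivity of `p` needed). [cite: HuybrechtsLehn1997, App. 2.A.7 (Flags of subsheaves)] -/
theorem forall_fst_eq_zero_of_selfExtension_of_not_deforms (π₀ : Representation k G V) (π₁ : G → Module.End k V) (h1 : π₁ 1 = 0)
    (hL : ∀ g h, π₁ (g * h) = π₁ g * π₀ h + π₀ g * π₁ h) (ρ : Representation k G (V × V))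
    (hρ : ∀ g v₀ v₁, ρ g (v₀, v₁) = (π₀ g v₀, π₁ g v₀ + π₀ g v₁)) (A : Submodule k V)
    (hAinv : ∀ g, A ≤ A.comap (π₀ g))
    (hAirr : ∀ B : Submodule k V, B ≤ A → (∀ g, B ≤ B.comap (π₀ g)) → B = ⊥ ∨ B = A)
    (hnd : ¬ ∃ L : A →ₗ[k] V, ∀ g (a : A), π₁ g (a : V) + π₀ g (L a) - L (π₀.subrepresentation A hAinv g a) ∈ A)
    (hHom0 : ∀ ψ : IntertwiningMap (π₀.subrepresentation A hAinv) (π₀.quotient A hAinv), ψ = 0)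
    (τ : Representation k G X) (ι : IntertwiningMap (π₀.subrepresentation A hAinv) τ) (p : IntertwiningMap τ (π₀.subrepresentation A hAinv))
    (hexact : LinearMap.ker p.toLinearMap = LinearMap.range ι.toLinearMap)
    (φ : X →ₗ[k] V × V) (hφ : ∀ g x, φ (τ g x) = ρ g (φ x)) (x : X) : (φ x).1 = 0 :=
  forall_fst_eq_zero_of_not_deforms π₀ π₁ h1 hL ρ hρ A hAinv hAirr hnd τ φ hφ
    (forall_apply_mem_of_selfExtension π₀ A hAinv hAirr hHom0 τ ι p hexact) x

end HomCount

end Literature.RepresentationTheory
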